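import Summits.QuantumFields.QCD.Theses.QuarksAsStableAction
import Summits.QuantumFields.QCD.Theses.WilsonQuarkChessboard
import Literature.MathematicalPhysics.QuantumLattice.WilsonDiracAP
import Summits.QuantumFields.QCD.Theorems.QuarksAsStableActionWilsonQuarkStabilityEvenOfQuarkChessboard
import Summits.QuantumFields.QCD.Theorems.QuarksAsStableActionCriticalLineDiamagnetismStubQuarkChessboardOfSchwarz

/-!
# Parity glue and the even half modulo item 10349 (line `Sketch`, crux `QuarksAsStableAction.WilsonQuarkStability`,
item stmt-QuantumFields-9736; helpers, `--supports`)

Two sorry-free pieces of the cycle-2 skeleton of line `Sketch` (idea `free-tangent-landau-chessboard`):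

* `wilsonQuarkStabilityEven_of_backgroundSchwarz` — item stmt-QuantumFields-10349
  (`WilsonQuarkChessboard.BackgroundSchwarz`, the background Schwarz inequality of the all-axes antiperiodic `r = 1`
  Wilson determinant) implies the crux VERBATIM with `Even L →` inserted: the composition of the sibling lead's
  `ChessboardCellGain.stub_quarkChessboard_of_schwarz` (FILS iteration, p112660) with this line's
  `stub_evenOfQuarkChessboard` (stubs 1–6, p111179).  So the even-volume half of the crux hinges on item 10349 alone.
* `wilsonQuarkStability_of_even_of_odd` — the crux on even tori and the crux on odd tori (each verbatim with one
  parity token inserted) give the crux as typed; the only content is the monotone merging of the two constant sets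
  (`stabilityExponent_mono`: shrinking `δ`, enlarging `K`, `c₂ ↦ max(c₂, 0)`, `C ↦ max(C, 0, c₂·δ_old)` can only
  increase `K + c₂·S_good(δ) + C·N_bad(δ)` because plaquette deficits are non-negative,
  `plaquetteDeficit_nonneg`).  The odd half is the line's registered stub `stub_oddVolumes` (not a lemma of this
  line: reflection tilings / Schatten localisations on the isotropic torus need even side).

Pure theorem file (no `def`s); statements are inlined so that nothing is vendored.
-/

namespace Summit.QuantumFields.QCD.Cruxes.WilsonQuarkStability.FreeTangentLandauChessboard

open Literature.MathematicalPhysics Literature.MathematicalPhysics.QuantumLattice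
  Literature.MathematicalPhysics.QuantumFieldTheory
open Matrix Complex
open scoped ComplexConjugate BigOperators

noncomputable section

/-! ## The even half modulo item 10349 -/

/-- **Even tori, modulo the background Schwarz inequality**: item stmt-QuantumFields-10349
(`WilsonQuarkChessboard.BackgroundSchwarz`, by name) implies the crux `QuarksAsStableAction.WilsonQuarkStability`
verbatim with `Even L →` inserted (written let-free, literally the conclusion of `stub_evenOfQuarkChessboard`). -/
theorem wilsonQuarkStabilityEven_of_backgroundSchwarz :
    Summit.QuantumFields.QCD.Theses.WilsonQuarkChessboard.BackgroundSchwarz →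
      ∃ ε δ K c₂ C : ℝ, 0 < ε ∧ 0 < δ ∧ ∃ L₀ : ℕ, ∀ (L : ℕ) [NeZero L], L₀ ≤ L → Even L →
        ∀ m : ℝ, |m| ≤ ε → ∀ U : Literature.MathematicalPhysics.QuantumFieldTheory.GaugeConfig 4 L (Matrix.specialUnitaryGroup (Fin 3) ℂ),
          ‖Literature.MathematicalPhysics.QuantumLattice.fermionDet (Literature.MathematicalPhysics.QuantumLattice.wilsonDirac (Literature.MathematicalPhysics.QuantumLattice.unitaryFundamentalRep (Fin 3) ℂ) (fun e => if e.1 e.2 = -1 then -(⟨(U e).1, Matrix.specialUnitaryGroup_le_unitaryGroup (U e).2⟩ : Matrix.unitaryGroup (Fin 3) ℂ) else ⟨(U e).1, Matrix.specialUnitaryGroup_le_unitaryGroup (U e).2⟩) m 1)‖ ≤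
            Real.exp (K + c₂ * (∑ p ∈ Finset.univ.filter (fun p : Literature.MathematicalPhysics.QuantumFieldTheory.Plaquette 4 L => (3 - (Literature.MathematicalPhysics.QuantumLattice.fundamentalRep (Fin 3) (Literature.MathematicalPhysics.QuantumFieldTheory.plaquetteHolonomy U p.1 p.2.1.1 p.2.1.2)).trace.re) < δ), (3 - (Literature.MathematicalPhysics.QuantumLattice.fundamentalRep (Fin 3) (Literature.MathematicalPhysics.QuantumFieldTheory.plaquetteHolonomy U p.1 p.2.1.1 p.2.1.2)).trace.re)) +
              C * ((Finset.univ.filter (fun p : Literature.MathematicalPhysics.QuantumFieldTheory.Plaquette 4 L => δ ≤ (3 - (Literature.MathematicalPhysics.QuantumLattice.fundamentalRep (Fin 3) (Literature.MathematicalPhysics.QuantumFieldTheory.plaquetteHolonomy U p.1 p.2.1.1 p.2.1.2)).trace.re))).card : ℝ)) *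
            ‖Literature.MathematicalPhysics.QuantumLattice.fermionDet (Literature.MathematicalPhysics.QuantumLattice.wilsonDirac (Literature.MathematicalPhysics.QuantumLattice.unitaryFundamentalRep (Fin 3) ℂ) (fun e => if e.1 e.2 = -1 then -(⟨((1 : Literature.MathematicalPhysics.QuantumFieldTheory.GaugeConfig 4 L (Matrix.specialUnitaryGroup (Fin 3) ℂ)) e).1, Matrix.specialUnitaryGroup_le_unitaryGroup ((1 : Literature.MathematicalPhysics.QuantumFieldTheory.GaugeConfig 4 L (Matrix.specialUnitaryGroup (Fin 3) ℂ)) e).2⟩ : Matrix.unitaryGroup (Fin 3) ℂ) else ⟨((1 : Literature.MathematicalPhysics.QuantumFieldTheory.GaugeConfig 4 L (Matrix.specialUnitaryGroup (Fin 3) ℂ)) e).1, Matrix.specialUnitaryGroup_le_unitaryGroup ((1 : Literature.MathematicalPhysics.QuantumFieldTheory.GaugeConfig 4 L (Matrix.specialUnitaryGroup (Fin 3) ℂ)) e).2⟩) m 1)‖ :=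
  fun hBS => stub_evenOfQuarkChessboard
    (Summit.QuantumFields.QCD.Cruxes.CriticalLineDiamagnetism.ChessboardCellGain.stub_quarkChessboard_of_schwarz
      hBS)

/-! ## Parity glue -/

/-- Monotone merging of the constants of the stability bound: shrinking `δ` and enlarging `K`, `c₂` (to a
non-negative value) and `C ≥ c₂·δ_old` can only increase `K + c₂·S_good(δ) + C·N_bad(δ)` when all deficits are non-negative. -/
theorem stabilityExponent_mono {ι : Type*} (s : Finset ι) (f : ι → ℝ) (hf : ∀ p, 0 ≤ f p)
    {K c C δ K' c' C' δ' : ℝ} (hδ' : δ' ≤ δ) (hK : K ≤ K') (hc : c ≤ c') (hc' : 0 ≤ c')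
    (hC : C ≤ C') (hcδ : c' * δ ≤ C') :
    K + c * (∑ p ∈ s.filter (fun p => f p < δ), f p) + C * ((s.filter fun p => δ ≤ f p).card : ℝ) ≤
      K' + c' * (∑ p ∈ s.filter (fun p => f p < δ'), f p) + C' * ((s.filter fun p => δ' ≤ f p).card : ℝ) := by
  classical
  -- split the `δ`-good plaquettes into the `δ'`-good ones and the middle band `δ' ≤ f < δ`
  have hsplit : ∑ p ∈ s.filter (fun p => f p < δ), f p =
      (∑ p ∈ s.filter (fun p => f p < δ'), f p) +
        ∑ p ∈ (s.filter fun p => f p < δ).filter (fun p => δ' ≤ f p), f p := by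
    rw [← Finset.sum_filter_add_sum_filter_not (s.filter fun p => f p < δ) (fun p => f p < δ')]
    congr 1
    · apply Finset.sum_congr _ (fun _ _ => rfl)
      ext p
      simp only [Finset.mem_filter, and_assoc]
      exact ⟨fun h => ⟨h.1, h.2.2⟩, fun h => ⟨h.1, lt_of_lt_of_le h.2 hδ', h.2⟩⟩
    · apply Finset.sum_congr _ (fun _ _ => rfl)
      ext p
      simp only [Finset.mem_filter, not_lt]
  -- the middle band and the `δ`-bad plaquettes together are the `δ'`-bad plaquettes
  have hcard : (((s.filter fun p => f p < δ).filter (fun p => δ' ≤ f p)).card : ℝ) +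
      ((s.filter fun p => δ ≤ f p).card : ℝ) = ((s.filter fun p => δ' ≤ f p).card : ℝ) := by
    rw [← Nat.cast_add, ← Finset.card_union_of_disjoint]
    · congr 2
      ext p
      simp only [Finset.mem_union, Finset.mem_filter]
      constructor
      · rintro (⟨⟨hp, -⟩, h⟩ | ⟨hp, h⟩)
        · exact ⟨hp, h⟩
        · exact ⟨hp, hδ'.trans h⟩
      · rintro ⟨hp, h⟩
        rcases lt_or_ge (f p) δ with h' | h'
        · exact Or.inl ⟨⟨hp, h'⟩, h⟩
        · exact Or.inr ⟨hp, h'⟩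
    · rw [Finset.disjoint_left]
      rintro p hp hp'
      simp only [Finset.mem_filter] at hp hp'
      exact absurd hp.1.2 (not_lt.2 hp'.2)
  have hS0 : 0 ≤ ∑ p ∈ s.filter (fun p => f p < δ), f p := Finset.sum_nonneg fun p _ => hf p
  have hS0' : 0 ≤ ∑ p ∈ s.filter (fun p => f p < δ'), f p := Finset.sum_nonneg fun p _ => hf p
  have hband : ∑ p ∈ (s.filter fun p => f p < δ).filter (fun p => δ' ≤ f p), f p ≤
      δ * (((s.filter fun p => f p < δ).filter (fun p => δ' ≤ f p)).card : ℝ) := by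
    rw [mul_comm, ← nsmul_eq_mul, ← Finset.sum_const]
    exact Finset.sum_le_sum fun p hp => by
      simp only [Finset.mem_filter] at hp
      exact hp.1.2.le
  have hN0 : (0 : ℝ) ≤ ((s.filter fun p => δ ≤ f p).card : ℝ) := Nat.cast_nonneg _
  have hB0 : (0 : ℝ) ≤ (((s.filter fun p => f p < δ).filter (fun p => δ' ≤ f p)).card : ℝ) :=
    Nat.cast_nonneg _
  -- assemble
  have h1 : c * (∑ p ∈ s.filter (fun p => f p < δ), f p) ≤ c' * (∑ p ∈ s.filter (fun p => f p < δ), f p) :=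
    mul_le_mul_of_nonneg_right hc hS0
  have h2 : C * ((s.filter fun p => δ ≤ f p).card : ℝ) ≤ C' * ((s.filter fun p => δ ≤ f p).card : ℝ) :=
    mul_le_mul_of_nonneg_right hC hN0
  have h3 : c' * ∑ p ∈ (s.filter fun p => f p < δ).filter (fun p => δ' ≤ f p), f p ≤
      C' * (((s.filter fun p => f p < δ).filter (fun p => δ' ≤ f p)).card : ℝ) :=
    calc c' * ∑ p ∈ (s.filter fun p => f p < δ).filter (fun p => δ' ≤ f p), f p
        ≤ c' * (δ * (((s.filter fun p => f p < δ).filter (fun p => δ' ≤ f p)).card : ℝ)) :=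
          mul_le_mul_of_nonneg_left hband hc'
      _ = (c' * δ) * (((s.filter fun p => f p < δ).filter (fun p => δ' ≤ f p)).card : ℝ) := by ring
      _ ≤ C' * (((s.filter fun p => f p < δ).filter (fun p => δ' ≤ f p)).card : ℝ) :=
          mul_le_mul_of_nonneg_right hcδ hB0
  rw [← hcard, hsplit] at *
  rw [hsplit] at h1
  nlinarith [h1, h2, h3, hK, mul_add c' (∑ p ∈ s.filter (fun p => f p < δ'), f p)
    (∑ p ∈ (s.filter fun p => f p < δ).filter (fun p => δ' ≤ f p), f p)]

/-- **Parity glue**: the crux on even tori (first hypothesis: `WilsonQuarkStability` verbatim with `Even L →`)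
and the crux on odd tori (second hypothesis: verbatim with `Odd L →`) give the crux as typed, BY NAME, with
`ε = min`, `δ = min`, `K = max`, `c₂ = max(·,·,0)`, `C = max(·,·,0, c₂·max δ)`, `L₀ = max`. -/
theorem wilsonQuarkStability_of_even_of_odd :
    (∃ ε δ K c₂ C : ℝ, 0 < ε ∧ 0 < δ ∧ ∃ L₀ : ℕ, ∀ (L : ℕ) [NeZero L], L₀ ≤ L → Even L → let apDet : Literature.MathematicalPhysics.QuantumFieldTheory.GaugeConfig 4 L (Matrix.specialUnitaryGroup (Fin 3) ℂ) → ℝ → ℂ := fun U m => Literature.MathematicalPhysics.QuantumLattice.fermionDet (Literature.MathematicalPhysics.QuantumLattice.wilsonDirac (Literature.MathematicalPhysics.QuantumLattice.unitaryFundamentalRep (Fin 3) ℂ) (fun e => if e.1 e.2 = -1 then -(⟨(U e).1, Matrix.specialUnitaryGroup_le_unitaryGroup (U e).2⟩ : Matrix.unitaryGroup (Fin 3) ℂ) else ⟨(U e).1, Matrix.specialUnitaryGroup_le_unitaryGroup (U e).2⟩) m 1); let dfc : Literature.MathematicalPhysics.QuantumFieldTheory.GaugeConfig 4 L (Matrix.specialUnitaryGroup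 (Fin 3) ℂ) → Literature.MathematicalPhysics.QuantumFieldTheory.Plaquette 4 L → ℝ := fun U p => 3 - (Literature.MathematicalPhysics.QuantumLattice.fundamentalRep (Fin 3) (Literature.MathematicalPhysics.QuantumFieldTheory.plaquetteHolonomy U p.1 p.2.1.1 p.2.1.2)).trace.re; ∀ m : ℝ, |m| ≤ ε → ∀ U : Literature.MathematicalPhysics.QuantumFieldTheory.GaugeConfig 4 L (Matrix.specialUnitaryGroup (Fin 3) ℂ), ‖apDet U m‖ ≤ Real.exp (K + c₂ * (∑ p ∈ Finset.univ.filter (fun p => dfc U p < δ), dfc U p) + C * ((Finset.univ.filter (fun p => δ ≤ dfc U p)).card : ℝ)) * ‖apDet 1 m‖) →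
    (∃ ε δ K c₂ C : ℝ, 0 < ε ∧ 0 < δ ∧ ∃ L₀ : ℕ, ∀ (L : ℕ) [NeZero L], L₀ ≤ L → Odd L → let apDet : Literature.MathematicalPhysics.QuantumFieldTheory.GaugeConfig 4 L (Matrix.specialUnitaryGroup (Fin 3) ℂ) → ℝ → ℂ := fun U m => Literature.MathematicalPhysics.QuantumLattice.fermionDet (Literature.MathematicalPhysics.QuantumLattice.wilsonDirac (Literature.MathematicalPhysics.QuantumLattice.unitaryFundamentalRep (Fin 3) ℂ) (fun e => if e.1 e.2 = -1 then -(⟨(U e).1, Matrix.specialUnitaryGroup_le_unitaryGroup (U e).2⟩ : Matrix.unitaryGroup (Fin 3) ℂ) else ⟨(U e).1, Matrix.specialUnitaryGroup_le_unitaryGroup (U e).2⟩) m 1); let dfc : Literature.MathematicalPhysics.QuantumFieldTheory.GaugeConfig 4 L (Matrix.specialUnitaryGroup (Fin 3) ℂ) → Literature.MathematicalPhysics.QuantumFieldTheory.Plaquette 4 L → ℝ := fun U p => 3 - (Literature.MathematicalPhysics.QuantumLattice.fundamentalRep (Fin 3) (Literature.MathematicalPhysics.QuantumFieldTheory.plaquetteHolonomy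 U p.1 p.2.1.1 p.2.1.2)).trace.re; ∀ m : ℝ, |m| ≤ ε → ∀ U : Literature.MathematicalPhysics.QuantumFieldTheory.GaugeConfig 4 L (Matrix.specialUnitaryGroup (Fin 3) ℂ), ‖apDet U m‖ ≤ Real.exp (K + c₂ * (∑ p ∈ Finset.univ.filter (fun p => dfc U p < δ), dfc U p) + C * ((Finset.univ.filter (fun p => δ ≤ dfc U p)).card : ℝ)) * ‖apDet 1 m‖) →
    Summit.QuantumFields.QCD.Theses.QuarksAsStableAction.WilsonQuarkStability := by
  intro he ho
  obtain ⟨ε₁, δ₁, K₁, c₁, C₁, hε₁, hδ₁, L₁, H₁⟩ := he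
  obtain ⟨ε₂, δ₂, K₂, c₂, C₂, hε₂, hδ₂, L₂, H₂⟩ := ho
  refine ⟨min ε₁ ε₂, min δ₁ δ₂, max K₁ K₂, max (max c₁ c₂) 0,
    max (max (max C₁ C₂) 0) (max (max c₁ c₂) 0 * max δ₁ δ₂),
    lt_min hε₁ hε₂, lt_min hδ₁ hδ₂, max L₁ L₂, ?_⟩
  intro L _ hL apDet dfc m hm U
  obtain ⟨hL₁, hL₂⟩ := max_le_iff.1 hL
  have h0 : ∀ p, 0 ≤ dfc U p := fun p => by
    have hρ : ∀ g : Matrix.specialUnitaryGroup (Fin 3) ℂ,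
        fundamentalRep (Fin 3) g ∈ Matrix.unitaryGroup (Fin 3) ℂ :=
      fun g => Matrix.specialUnitaryGroup_le_unitaryGroup g.2
    have h := plaquetteDeficit_nonneg (fundamentalRep (Fin 3)) hρ U p
    simp only [plaquetteDeficit, Nat.cast_ofNat] at h
    exact h
  have hc'0 : (0 : ℝ) ≤ max (max c₁ c₂) 0 := le_max_right _ _
  rcases Nat.even_or_odd L with hE | hO
  · have h := H₁ L hL₁ hE m (hm.trans (min_le_left _ _)) U
    refine h.trans (mul_le_mul_of_nonneg_right (Real.exp_le_exp.2 ?_) (norm_nonneg _))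
    refine stabilityExponent_mono Finset.univ (dfc U) h0 (min_le_left _ _) (le_max_left _ _)
      ((le_max_left _ _).trans (le_max_left _ _)) hc'0
      (((le_max_left _ _).trans (le_max_left _ _)).trans (le_max_left _ _)) ?_
    exact (mul_le_mul_of_nonneg_left (le_max_left _ _) hc'0).trans (le_max_right _ _)
  · have h := H₂ L hL₂ hO m (hm.trans (min_le_right _ _)) U
    refine h.trans (mul_le_mul_of_nonneg_right (Real.exp_le_exp.2 ?_) (norm_nonneg _))
    refine stabilityExponent_mono Finset.univ (dfc U) h0 (min_le_right _ _) (le_max_right _ _)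
      ((le_max_right _ _).trans (le_max_left _ _)) hc'0
      (((le_max_right _ _).trans (le_max_left _ _)).trans (le_max_left _ _)) ?_
    exact (mul_le_mul_of_nonneg_left (le_max_right _ _) hc'0).trans (le_max_right _ _)

end

end Summit.QuantumFields.QCD.Cruxes.WilsonQuarkStability.FreeTangentLandauChessboard
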